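import Literature.NumberTheory.EllipticCurves.IsogenyDualElliptic
import Literature.NumberTheory.EllipticCurves.IsogenyCanonicalHeightProofs
import Literature.NumberTheory.EllipticCurves.IsogenyTwoPowerQuotientProofs
import Literature.NumberTheory.EllipticCurves.PAdicLFunction
import Literature.NumberTheory.EllipticCurves.SelmerCorankProofs
import Literature.NumberTheory.EllipticCurves.LambdaInvariantCongruenceTransportAtTwo
import Summits.BirchSwinnertonDyer.BirchSwinnertonDyer.Theorems.EisensteinDepletionAtTwoStarOptBNSFOddTransportArchHalves
import HarnessLib

/-!
# Transport of Greenberg's «odd» type along isogenies, III: the transport theorems (line `nsf` on crux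
# `StarOptBNSF`, item stmt-BirchSwinnertonDyer-27047 — the ARCHIMEDEAN half of `stub_oddIsogenyInvariance`)

Lead bsd-rank2-star-p1 GEN 7.  A `ℚ`-isogeny `ψ` is a homomorphism on `E(ℂ)` commuting with complex
conjugation (tree `Isogeny.map_conj_baseChange`), so it maps anti-real halves of `T` (part II) to anti-real
halves of `ψ T`:
* `twoTorsionOdd_of_isogeny_apply_eq` — `ψ T = T′` (geometric points) and `⟨T⟩` odd ⇒ `⟨T′⟩` odd (ANY degree);
* `twoTorsionOdd_iff_of_isogeny_apply_eq` — ODD degree: `⟨T⟩` odd ⟺ `⟨ψ T⟩` odd (dual isogeny, tree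
  `exists_dual_elliptic_holds`: `ψ̂ T′ = deg ψ • T = T`);
* `exists_hasUniqueRationalTwoTorsionX_of_isogeny_of_odd` — under an odd-degree isogeny a UNIQUE rational
  point of order `2` goes to a UNIQUE rational point of order `2` (Galois descent, tree
  `exists_toGeomPoints_eq_of_forall_smul_eq`; injectivity of `ψ̂` on `2`-torsion from `ψ ψ̂ = [deg ψ]`);
* `twoTorsionOdd_of_isogeny_of_unique` — degree-free forward corollary for a unique rational 2-torsion point of `W′`;
* `oddIsoArch` — line `nsf` v2's `stub_oddIsogenyInvariance` WITHOUT its 2-adic conjunct, verbatim binders;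
  `oddIsogenyInvariance_of_twoAdic` — the stub from the 2-adic half alone (glue for the planner's re-cut).

What is NOT here: the 2-ADIC half — an odd-degree isogeny between globally minimal models with good
reduction at `2` preserves `TwoTorsionRamifiedAtTwo` (`v₂(x) < 0`, the kernel of reduction; formal groups /
Néron models; NSF-STUBS-PLAN §3(B)) — and the 2-power walk (`stub_twoPowerWalk`).
HONEST FRAMING: a transport lemma under an OPEN crux; `StarOptBNSF` (27047) / `E1M_NSF` (27021) are NOT
proved by it; nothing here reads an analytic rank; BSD is not proved by this line.

References: R. Greenberg, LNM 1716 (1999), §5 p. 168, Remark p. 174 [GreenbergLNM1716]; J. H. Silverman,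
*AEC*, GTM 106 (2009), III.4.8, III.6.1–6.2, VIII.§1 [SilvermanAEC2009].
-/

set_option linter.dupNamespace false
set_option autoImplicit false

noncomputable section

open scoped Classical ComplexConjugate
open WeierstrassCurve Literature.NumberTheory.EllipticCurves
  Literature.NumberTheory.EllipticCurves.Greenberg1999 Complex

namespace Summit.BirchSwinnertonDyer.BirchSwinnertonDyer.Theorems.DepletionAtTwo.ArchTransport

/-! ### §3 Transport along an isogeny (with a fixed embedding `ℚ̄ → ℂ`) -/

section Transport

variable {W W' : WeierstrassCurve ℚ}

/-- The geometric point of a rational affine point, with its coordinates (`rfl`). [folklore] -/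
theorem toGeomPoints_some (V : WeierstrassCurve ℚ) {x y : ℚ} (h : V.toAffine.Nonsingular x y) :
    ∃ hC, V.toGeomPoints (.some x y h) =
      (.some (algebraMap ℚ (AlgebraicClosure ℚ) x) (algebraMap ℚ (AlgebraicClosure ℚ) y) hC : V.geomPoints) :=
  ⟨_, rfl⟩

/-- The geometric point of a rational point of order `2` is killed by `2`. [folklore] -/
theorem toGeomPoints_add_self_eq_zero (V : WeierstrassCurve ℚ) {x y : ℚ} (hT : V.toAffine.Nonsingular x y)
    (h2 : 2 * y + V.a₁ * x + V.a₃ = 0) :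
    V.toGeomPoints (.some x y hT) + V.toGeomPoints (.some x y hT) = 0 := by
  obtain ⟨hC, hG⟩ := toGeomPoints_some V hT
  rw [hG]
  apply Affine.Point.add_self_of_Y_eq
  rw [WeierstrassCurve.Affine.negY]
  have hy : y = -y - V.a₁ * x - V.a₃ := by linear_combination h2
  have h := congrArg (algebraMap ℚ (AlgebraicClosure ℚ)) hy
  rw [map_sub, map_sub, map_neg, map_mul] at h
  exact h

/-- The geometric point of a rational affine point is non-zero. [folklore] -/
theorem toGeomPoints_some_ne_zero' (V : WeierstrassCurve ℚ) {x y : ℚ} (hT : V.toAffine.Nonsingular x y) :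
    V.toGeomPoints (.some x y hT) ≠ 0 := by
  obtain ⟨hC, hG⟩ := toGeomPoints_some V hT
  rw [hG]
  rintro ⟨⟩

/-- If `ψ T = T′` for a rational point `T = (x, y)` of order `2`, then `T′ = (x′, y′)` has order `2`:
`2y′ + a₁′x′ + a₃′ = 0`. [cite: SilvermanAEC2009, III.4.8 (isogenies are homomorphisms)] -/
theorem two_torsion_of_isogeny_apply_eq (ψ : Isogeny W W') {x y x' y' : ℚ}
    (hT : W.toAffine.Nonsingular x y) (hT' : W'.toAffine.Nonsingular x' y')
    (h2 : 2 * y + W.a₁ * x + W.a₃ = 0)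
    (hψ : ψ (W.toGeomPoints (.some x y hT)) = W'.toGeomPoints (.some x' y' hT')) :
    2 * y' + W'.a₁ * x' + W'.a₃ = 0 := by
  by_contra hne
  obtain ⟨hC', hG'⟩ := toGeomPoints_some W' hT'
  have hne' : algebraMap ℚ (AlgebraicClosure ℚ) y' ≠
      (W'.baseChange (AlgebraicClosure ℚ)).toAffine.negY (algebraMap ℚ (AlgebraicClosure ℚ) x')
        (algebraMap ℚ (AlgebraicClosure ℚ) y') := by
    intro h
    apply hne
    rw [WeierstrassCurve.Affine.negY] at h
    have h' : algebraMap ℚ (AlgebraicClosure ℚ) y' =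
        algebraMap ℚ (AlgebraicClosure ℚ) (-y' - W'.a₁ * x' - W'.a₃) := by
      rw [map_sub, map_sub, map_neg, map_mul]; exact h
    have h'' := (algebraMap ℚ (AlgebraicClosure ℚ)).injective h'
    linear_combination h''
  have hsum : ψ (W.toGeomPoints (.some x y hT)) + ψ (W.toGeomPoints (.some x y hT)) = 0 := by
    rw [← map_add ψ, toGeomPoints_add_self_eq_zero W hT h2, map_zero ψ]
  rw [hψ, hG'] at hsum
  have hsum' : (Affine.Point.some _ _ hC' : (W'.baseChange (AlgebraicClosure ℚ)).toAffine.Point) +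
      (Affine.Point.some _ _ hC' : (W'.baseChange (AlgebraicClosure ℚ)).toAffine.Point) = 0 := hsum
  rw [Affine.Point.add_self_of_Y_ne hne'] at hsum'
  exact absurd hsum' (by rintro ⟨⟩)

/-- An isogeny of ODD degree maps the geometric point of a rational point of order `2` back and forth:
`ψ̂ (ψ T) = deg ψ • T = T`. [cite: SilvermanAEC2009, III.6.1 (a)] -/
theorem dual_apply_eq_of_odd [W.IsElliptic] [W'.IsElliptic] (ψ : Isogeny W W') (hdeg : Odd ψ.degree) {x y : ℚ}
    (hT : W.toAffine.Nonsingular x y) (h2 : 2 * y + W.a₁ * x + W.a₃ = 0) :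
    ∃ ψd : Isogeny W' W, ψd (ψ (W.toGeomPoints (.some x y hT))) = W.toGeomPoints (.some x y hT) := by
  obtain ⟨ψd, hψd⟩ := Isogeny.exists_dual_elliptic_holds (W := W) (W' := W') ψ
  refine ⟨ψd, ?_⟩
  obtain ⟨k, hk⟩ := hdeg
  rw [hψd, hk]
  push_cast
  rw [add_zsmul, one_zsmul, mul_comm, mul_zsmul, two_zsmul, toGeomPoints_add_self_eq_zero W hT h2,
    zsmul_zero, zero_add]

/-- An isogeny of odd degree does not kill a rational point of order `2`. [cite: SilvermanAEC2009, III.6.1 (a)] -/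
theorem isogeny_apply_ne_zero_of_odd [W.IsElliptic] [W'.IsElliptic] (ψ : Isogeny W W') (hdeg : Odd ψ.degree) {x y : ℚ}
    (hT : W.toAffine.Nonsingular x y) (h2 : 2 * y + W.a₁ * x + W.a₃ = 0) :
    ψ (W.toGeomPoints (.some x y hT)) ≠ 0 := by
  intro h0
  obtain ⟨ψd, hψd⟩ := dual_apply_eq_of_odd ψ hdeg hT h2
  rw [h0, map_zero ψd] at hψd
  exact toGeomPoints_some_ne_zero' W hT hψd.symm

variable [Algebra (AlgebraicClosure ℚ) ℂ] [IsScalarTower ℚ (AlgebraicClosure ℚ) ℂ]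

/-- The complex point of a rational affine point: `ι_* T = (x, y) ∈ W(ℂ)` for any embedding `ι : ℚ̄ → ℂ`.
[folklore] -/
theorem map_toGeomPoints_some (V : WeierstrassCurve ℚ) {x y : ℚ} (h : V.toAffine.Nonsingular x y) :
    ∃ (X Y : ℂ) (hC : (V.baseChange ℂ).toAffine.Nonsingular X Y),
      Affine.Point.map (W' := V) (IsScalarTower.toAlgHom ℚ (AlgebraicClosure ℚ) ℂ)
          (V.toGeomPoints (.some x y h)) = .some X Y hC ∧ X = (x : ℂ) ∧ Y = (y : ℂ) := by
  refine ⟨_, _, _, rfl, ?_, ?_⟩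
  · show (IsScalarTower.toAlgHom ℚ (AlgebraicClosure ℚ) ℂ) (algebraMap ℚ (AlgebraicClosure ℚ) x) = _
    rw [IsScalarTower.toAlgHom_apply, ← IsScalarTower.algebraMap_apply, eq_ratCast]
  · show (IsScalarTower.toAlgHom ℚ (AlgebraicClosure ℚ) ℂ) (algebraMap ℚ (AlgebraicClosure ℚ) y) = _
    rw [IsScalarTower.toAlgHom_apply, ← IsScalarTower.algebraMap_apply, eq_ratCast]

/-- **Transport of «odd» along an isogeny (fixed embedding `ℚ̄ → ℂ`).**  If `ψ T = T′` with `⟨T⟩` odd then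
`⟨T′⟩` is odd: an anti-real half `R` of `T` in `W(ℂ)` maps to the anti-real half `ψ_ℂ R` of `T′`
(`ψ_ℂ` is additive and commutes with conjugation, tree `Isogeny.map_conj_baseChange`).
[cite: GreenbergLNM1716, §5 p. 168] -/
theorem twoTorsionOdd_of_isogeny_apply_eq' [W.IsElliptic] (ψ : Isogeny W W') {x y x' y' : ℚ}
    (hT : W.toAffine.Nonsingular x y) (hT' : W'.toAffine.Nonsingular x' y')
    (h2 : 2 * y + W.a₁ * x + W.a₃ = 0)
    (hψ : ψ (W.toGeomPoints (.some x y hT)) = W'.toGeomPoints (.some x' y' hT'))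
    (hodd : TwoTorsionOdd W x) : TwoTorsionOdd W' x' := by
  have h2' := two_torsion_of_isogeny_apply_eq ψ hT hT' h2 hψ
  obtain ⟨σc, hσc⟩ := exists_algHom_conj_rat
  obtain ⟨X, Y, hC, hTC, hX, hY⟩ := map_toGeomPoints_some W hT
  obtain ⟨X', Y', hC', hTC', hX', -⟩ := map_toGeomPoints_some W' hT'
  obtain ⟨R, hanti, hhalf⟩ := exists_antireal_half_of_twoTorsionOdd hT.left h2 hodd σc hσc hC hX hY
  have hΦT : ψ.baseChange (M := ℂ) (.some X Y hC) = .some X' Y' hC' := by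
    calc ψ.baseChange (M := ℂ) (.some X Y hC)
        = ψ.baseChange (M := ℂ) (Affine.Point.map (W' := W)
            (IsScalarTower.toAlgHom ℚ (AlgebraicClosure ℚ) ℂ) (W.toGeomPoints (.some x y hT))) := by
          rw [hTC]
      _ = Affine.Point.map (W' := W') (IsScalarTower.toAlgHom ℚ (AlgebraicClosure ℚ) ℂ)
            (ψ (W.toGeomPoints (.some x y hT))) := Isogeny.baseChange_map (M := ℂ) ψ _
      _ = .some X' Y' hC' := by rw [hψ, hTC']
  have hanti' : Affine.Point.map (W' := W') σc (ψ.baseChange (M := ℂ) R) = -ψ.baseChange (M := ℂ) R := by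
    have e1 : Affine.Point.map (W' := W') σc (ψ.baseChange (M := ℂ) R) =
        ψ.baseChange (M := ℂ) (Affine.Point.map (W' := W) σc R) := Isogeny.map_conj_baseChange ψ σc R
    have e2 : ψ.baseChange (M := ℂ) (-R) = -ψ.baseChange (M := ℂ) R := (ψ.baseChange (M := ℂ)).map_neg R
    rw [e1, hanti, e2]
  have hhalf' : ψ.baseChange (M := ℂ) R + ψ.baseChange (M := ℂ) R = .some X' Y' hC' := by
    have e3 : ψ.baseChange (M := ℂ) R + ψ.baseChange (M := ℂ) R = ψ.baseChange (M := ℂ) (R + R) :=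
      ((ψ.baseChange (M := ℂ)).map_add R R).symm
    rw [e3, hhalf, hΦT]
  exact twoTorsionOdd_of_antireal_half hT'.left h2' σc hσc hanti' hX' (hP := hC') hhalf'

/-- **Odd degree: «odd» is invariant (fixed embedding).** [cite: GreenbergLNM1716, §5 p. 168] -/
theorem twoTorsionOdd_iff_of_isogeny_apply_eq' [W.IsElliptic] [W'.IsElliptic] (ψ : Isogeny W W') (hdeg : Odd ψ.degree)
    {x y x' y' : ℚ} (hT : W.toAffine.Nonsingular x y) (hT' : W'.toAffine.Nonsingular x' y')
    (h2 : 2 * y + W.a₁ * x + W.a₃ = 0)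
    (hψ : ψ (W.toGeomPoints (.some x y hT)) = W'.toGeomPoints (.some x' y' hT')) :
    TwoTorsionOdd W x ↔ TwoTorsionOdd W' x' := by
  have h2' := two_torsion_of_isogeny_apply_eq ψ hT hT' h2 hψ
  refine ⟨twoTorsionOdd_of_isogeny_apply_eq' ψ hT hT' h2 hψ, fun hodd' ↦ ?_⟩
  obtain ⟨ψd, hψd⟩ := dual_apply_eq_of_odd ψ hdeg hT h2
  rw [hψ] at hψd
  exact twoTorsionOdd_of_isogeny_apply_eq' ψd hT' hT h2' hψd hodd'

end Transport

/-! ### §4 The headline statements (no embedding in the signature) -/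

section Headline

variable {W W' : WeierstrassCurve ℚ}

/-- **Greenberg's «odd» type is transported along every ℚ-isogeny.**  For a `ℚ`-isogeny `ψ : W → W′` of
elliptic curves and rational points `T = (x, y)`, `T′ = (x′, y′)` with `2y + a₁x + a₃ = 0` and
`ψ T = T′` (on geometric points): if `x` is the least real root of the 2-division cubic of `W` (`⟨T⟩` odd,
`T ∈ C_∞[2]`) then `x′` is the least real root of the 2-division cubic of `W′`.  Proof: oddness is «`T` has
an anti-real half in `E(ℂ)`», preserved by `ψ_ℂ`, which commutes with complex conjugation.
[cite: GreenbergLNM1716, §5 p. 168 («odd»: Φ ⊆ C_∞) and Remark p. 174 (minimal x-coordinate)] -/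
theorem twoTorsionOdd_of_isogeny_apply_eq [W.IsElliptic] (ψ : Isogeny W W') {x y x' y' : ℚ}
    (hT : W.toAffine.Nonsingular x y) (hT' : W'.toAffine.Nonsingular x' y')
    (h2 : 2 * y + W.a₁ * x + W.a₃ = 0)
    (hψ : ψ (W.toGeomPoints (.some x y hT)) = W'.toGeomPoints (.some x' y' hT'))
    (hodd : TwoTorsionOdd W x) : TwoTorsionOdd W' x' := by
  haveI : Algebra.IsAlgebraic ℚ (AlgebraicClosure ℚ) := AlgebraicClosure.isAlgebraic ℚ
  obtain ⟨j⟩ : Nonempty ((AlgebraicClosure ℚ) →ₐ[ℚ] ℂ) := ⟨IsAlgClosed.lift⟩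
  letI : Algebra (AlgebraicClosure ℚ) ℂ := j.toRingHom.toAlgebra
  haveI : IsScalarTower ℚ (AlgebraicClosure ℚ) ℂ :=
    IsScalarTower.of_algebraMap_eq fun q ↦ (j.commutes q).symm
  exact twoTorsionOdd_of_isogeny_apply_eq' ψ hT hT' h2 hψ hodd

/-- **For an isogeny of ODD degree «odd» is invariant**: with `ψ T = T′` as above and `deg ψ` odd,
`TwoTorsionOdd W x ↔ TwoTorsionOdd W′ x′` (the dual isogeny maps `T′` to `deg ψ • T = T`).
[cite: GreenbergLNM1716, §5 p. 168] [cite: SilvermanAEC2009, III.6.1 (a)] -/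
theorem twoTorsionOdd_iff_of_isogeny_apply_eq [W.IsElliptic] [W'.IsElliptic] (ψ : Isogeny W W')
    (hdeg : Odd ψ.degree)
    {x y x' y' : ℚ} (hT : W.toAffine.Nonsingular x y) (hT' : W'.toAffine.Nonsingular x' y')
    (h2 : 2 * y + W.a₁ * x + W.a₃ = 0)
    (hψ : ψ (W.toGeomPoints (.some x y hT)) = W'.toGeomPoints (.some x' y' hT')) :
    TwoTorsionOdd W x ↔ TwoTorsionOdd W' x' := by
  haveI : Algebra.IsAlgebraic ℚ (AlgebraicClosure ℚ) := AlgebraicClosure.isAlgebraic ℚ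
  obtain ⟨j⟩ : Nonempty ((AlgebraicClosure ℚ) →ₐ[ℚ] ℂ) := ⟨IsAlgClosed.lift⟩
  letI : Algebra (AlgebraicClosure ℚ) ℂ := j.toRingHom.toAlgebra
  haveI : IsScalarTower ℚ (AlgebraicClosure ℚ) ℂ :=
    IsScalarTower.of_algebraMap_eq fun q ↦ (j.commutes q).symm
  exact twoTorsionOdd_iff_of_isogeny_apply_eq' ψ hdeg hT hT' h2 hψ

/-- The same for the relation `IsIsogenous` is NOT available degree-free (a 2-isogeny flips the type, tree
`twoTorsionOdd_iff_not_of_twoIsogeny`); recorded instead: along ANY isogeny mapping the unique rational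
2-torsion point of `W` to a non-zero point, the image is the unique rational 2-torsion point of `W′` and
oddness passes forward. [cite: GreenbergLNM1716, §5 p. 168] -/
theorem twoTorsionOdd_of_isogeny_of_unique [W.IsElliptic] (ψ : Isogeny W W') {x y x' : ℚ}
    (hT : W.toAffine.Nonsingular x y) (h2 : 2 * y + W.a₁ * x + W.a₃ = 0)
    (hne : ψ (W.toGeomPoints (.some x y hT)) ≠ 0) (hx' : HasUniqueRationalTwoTorsionX W' x')
    (hodd : TwoTorsionOdd W x) : TwoTorsionOdd W' x' := by
  obtain ⟨⟨y', hxy', h2'⟩, huniq'⟩ := hx'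
  have hfix : ∀ σ : Field.absoluteGaloisGroup ℚ,
      σ • ψ (W.toGeomPoints (.some x y hT)) = ψ (W.toGeomPoints (.some x y hT)) := fun σ ↦ by
    rw [← ψ.map_smul, WeierstrassCurve.smul_toGeomPoints]
  obtain ⟨P, hP⟩ := WeierstrassCurve.exists_toGeomPoints_eq_of_forall_smul_eq W' hfix
  rcases P with _ | ⟨x₁, y₁, h₁⟩
  · exact absurd (show ψ (W.toGeomPoints (.some x y hT)) = 0 by rw [← hP]; rfl) hne
  have h2₁ : 2 * y₁ + W'.a₁ * x₁ + W'.a₃ = 0 := two_torsion_of_isogeny_apply_eq ψ hT h₁ h2 hP.symm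
  have hx₁ : x₁ = x' := huniq' x₁ ⟨y₁, h₁.left, h2₁⟩
  subst hx₁
  exact twoTorsionOdd_of_isogeny_apply_eq ψ hT h₁ h2 hP.symm hodd

end Headline

/-! ### §5 The by-name shape for line `nsf` v2: rational 2-torsion corresponds under an odd isogeny, and
the archimedean half `oddIsoArch` of `stub_oddIsogenyInvariance` -/

section OddIso

variable {W W' : WeierstrassCurve ℚ}

/-- **Under an isogeny of ODD degree the rational points of order `2` correspond; in particular
uniqueness transfers**: if `W` has exactly one rational point of order `2` then so has `W′`, and the
isogeny maps the one to the other.  (`ψ T ≠ O` is `Γ_ℚ`-fixed of order `2`, hence rational by Galois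
descent; two rational points of order `2` on `W′` would be mapped by the dual isogeny `ψ̂` — also of odd
degree, tree `degree_eq_of_comp_eq_degree_smul`, hence injective on `2`-torsion since `ψ ψ̂ = [deg ψ]` —
to two distinct rational points of order `2` on `W`.) [cite: SilvermanAEC2009, III.6.1–6.2, VIII.§1] -/
theorem exists_hasUniqueRationalTwoTorsionX_of_isogeny_of_odd [W.IsElliptic] [W'.IsElliptic]
    (ψ : Isogeny W W') (hdeg : Odd ψ.degree) {x y : ℚ} (hT : W.toAffine.Nonsingular x y)
    (h2 : 2 * y + W.a₁ * x + W.a₃ = 0) (huniq : ∀ z : ℚ, HasRationalTwoTorsionX W z → z = x) :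
    ∃ (x' y' : ℚ) (hT' : W'.toAffine.Nonsingular x' y'),
      ψ (W.toGeomPoints (.some x y hT)) = W'.toGeomPoints (.some x' y' hT') ∧
        HasUniqueRationalTwoTorsionX W' x' := by
  have hfix : ∀ σ : Field.absoluteGaloisGroup ℚ,
      σ • ψ (W.toGeomPoints (.some x y hT)) = ψ (W.toGeomPoints (.some x y hT)) := fun σ ↦ by
    rw [← ψ.map_smul, WeierstrassCurve.smul_toGeomPoints]
  obtain ⟨P, hP⟩ := WeierstrassCurve.exists_toGeomPoints_eq_of_forall_smul_eq W' hfix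
  rcases P with _ | ⟨x₁, y₁, h₁⟩
  · exact absurd (show ψ (W.toGeomPoints (.some x y hT)) = 0 by rw [← hP]; rfl)
      (isogeny_apply_ne_zero_of_odd ψ hdeg hT h2)
  have h2₁ : 2 * y₁ + W'.a₁ * x₁ + W'.a₃ = 0 := two_torsion_of_isogeny_apply_eq ψ hT h₁ h2 hP.symm
  refine ⟨x₁, y₁, h₁, hP.symm, ⟨y₁, h₁.left, h2₁⟩, fun z hz ↦ ?_⟩
  -- uniqueness on `W′` via the dual isogeny
  obtain ⟨w, hzw, h2w⟩ := hz
  have hZ : W'.toAffine.Nonsingular z w := (WeierstrassCurve.Affine.equation_iff_nonsingular).mp hzw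
  obtain ⟨ψd, hψd⟩ := Isogeny.exists_dual_elliptic_holds (W := W) (W' := W') ψ
  have hdegd : Odd ψd.degree := by
    rw [Isogeny.degree_eq_of_comp_eq_degree_smul ψ ψd hψd]; exact hdeg
  -- both `ψd (z, w)` and `ψd (x₁, y₁)` are THE rational point `(x, y)` of `W`
  have himg : ∀ {u v : ℚ} (huv : W'.toAffine.Nonsingular u v), 2 * v + W'.a₁ * u + W'.a₃ = 0 →
      ψd (W'.toGeomPoints (.some u v huv)) = W.toGeomPoints (.some x y hT) := by
    intro u v huv h2uv
    have hfix' : ∀ σ : Field.absoluteGaloisGroup ℚ,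
        σ • ψd (W'.toGeomPoints (.some u v huv)) = ψd (W'.toGeomPoints (.some u v huv)) := fun σ ↦ by
      rw [← ψd.map_smul, WeierstrassCurve.smul_toGeomPoints]
    obtain ⟨Q, hQ⟩ := WeierstrassCurve.exists_toGeomPoints_eq_of_forall_smul_eq W hfix'
    rcases Q with _ | ⟨x₂, y₂, h₂⟩
    · exact absurd (show ψd (W'.toGeomPoints (.some u v huv)) = 0 by rw [← hQ]; rfl)
        (isogeny_apply_ne_zero_of_odd ψd hdegd huv h2uv)
    have h2₂ : 2 * y₂ + W.a₁ * x₂ + W.a₃ = 0 := two_torsion_of_isogeny_apply_eq ψd huv h₂ h2uv hQ.symm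
    have hx₂ : x₂ = x := huniq x₂ ⟨y₂, h₂.left, h2₂⟩
    subst hx₂
    have hy₂ : y₂ = y := eq_of_equation_of_two_torsion W hT.left h2 h₂.left
    subst hy₂
    exact hQ.symm
  -- hence `ψd` identifies them, and `ψ ψd = [deg ψ]` with `deg ψ` odd separates 2-torsion points
  have hcomp : ∀ Q : W'.geomPoints, ψ (ψd Q) = ψ.degree • Q :=
    Isogeny.comp_apply_eq_nsmul_of_comp_apply_eq_nsmul ψ ψd (fun P ↦ by
      rw [hψd, natCast_zsmul])
  set D : W'.geomPoints := W'.toGeomPoints (.some z w hZ) - W'.toGeomPoints (.some x₁ y₁ h₁) with hD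
  have hD0 : ψd D = 0 := by rw [hD, map_sub, himg hZ h2w, himg h₁ h2₁, sub_self]
  have hDD : D + D = 0 := by
    have hz2 := toGeomPoints_add_self_eq_zero W' hZ h2w
    have hx2 := toGeomPoints_add_self_eq_zero W' h₁ h2₁
    have e : D + D = (W'.toGeomPoints (.some z w hZ) + W'.toGeomPoints (.some z w hZ)) -
        (W'.toGeomPoints (.some x₁ y₁ h₁) + W'.toGeomPoints (.some x₁ y₁ h₁)) := by rw [hD]; abel
    rw [e, hz2, hx2, sub_zero]
  have hDeq : D = 0 := by
    have hodd : ψ.degree • D = D := by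
      -- an odd multiple of an element killed by `2` is the element (cf. the tree's
      -- `GoldfeldGoodTwists.odd_smul_eq_self_of_add_self`, not imported to keep this file light)
      obtain ⟨k, hk⟩ := hdeg
      rw [hk, add_nsmul, one_nsmul, mul_nsmul, two_nsmul, hDD, nsmul_zero, zero_add]
    have := hcomp D
    rw [hD0, map_zero, hodd] at this
    exact this.symm
  have hpt : (Affine.Point.some z w hZ : W'.toAffine.Point) = .some x₁ y₁ h₁ :=
    WeierstrassCurve.toGeomPoints_injective W' (sub_eq_zero.mp (by rw [← hD]; exact hDeq))
  exact (Affine.Point.some.inj hpt).left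

/-- **`oddIsoArch` — the ARCHIMEDEAN half of line `nsf` v2's `stub_oddIsogenyInvariance`, in its binder
shape.**  For a `ℚ`-isogeny `φ : W → W′` of odd degree (any models; the minimality / ordinarity binders of
the stub are carried but not used) and the unique rational 2-torsion abscissa `x` of `W`: `W′` has a unique
rational 2-torsion abscissa `x′`, and `⟨(x, ·)⟩` is odd iff `⟨(x′, ·)⟩` is odd.  The 2-ADIC conjunct
(`TwoTorsionRamifiedAtTwo x ↔ TwoTorsionRamifiedAtTwo x′`) of the stub is NOT proved here; see
`oddIsogenyInvariance_of_twoAdic` for the glue. [cite: GreenbergLNM1716, §5 p. 168 and Remark p. 174] -/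
theorem oddIsoArch :
    ∀ (W W' : WeierstrassCurve ℚ) [W.IsElliptic] [W.IsGloballyMinimal] [W'.IsElliptic]
      [W'.IsGloballyMinimal] (φ : WeierstrassCurve.Isogeny W W'), Odd φ.degree → IsOrdinaryAt W 2 →
      ∀ x : ℚ, HasUniqueRationalTwoTorsionX W x →
        ∃ x' : ℚ, HasUniqueRationalTwoTorsionX W' x' ∧ (TwoTorsionOdd W x ↔ TwoTorsionOdd W' x') := by
  intro W W' _ _ _ _ φ hdeg _ x hx
  obtain ⟨⟨y, hxy, h2⟩, huniq⟩ := hx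
  have hT : W.toAffine.Nonsingular x y := (WeierstrassCurve.Affine.equation_iff_nonsingular).mp hxy
  obtain ⟨x', y', hT', hφ, hx'⟩ := exists_hasUniqueRationalTwoTorsionX_of_isogeny_of_odd φ hdeg hT h2 huniq
  exact ⟨x', hx', twoTorsionOdd_iff_of_isogeny_apply_eq φ hdeg hT hT' h2 hφ⟩

/-- **Glue for the planner's re-cut** (NSF-STUBS-PLAN §3): the 2-ADIC half alone — «an odd-degree isogeny
between globally minimal models, `W` good ordinary at `2`, preserves `TwoTorsionRamifiedAtTwo` of the
unique rational 2-torsion abscissae» (hypothesis `hTwoAdic`, the line's residual local input: formal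
groups / Néron models, NOT proved in the tree) — implies `stub_oddIsogenyInvariance` of line `nsf` v2
verbatim, the archimedean conjunct being `oddIsoArch`. [cite: GreenbergLNM1716, §5 p. 168] -/
theorem oddIsogenyInvariance_of_twoAdic
    (hTwoAdic : ∀ (W W' : WeierstrassCurve ℚ) [W.IsElliptic] [W.IsGloballyMinimal] [W'.IsElliptic]
      [W'.IsGloballyMinimal] (φ : WeierstrassCurve.Isogeny W W'), Odd φ.degree → IsOrdinaryAt W 2 →
      ∀ x x' : ℚ, HasUniqueRationalTwoTorsionX W x → HasUniqueRationalTwoTorsionX W' x' →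
        (TwoTorsionRamifiedAtTwo x ↔ TwoTorsionRamifiedAtTwo x')) :
    ∀ (W W' : WeierstrassCurve ℚ) [W.IsElliptic] [W.IsGloballyMinimal] [W'.IsElliptic]
      [W'.IsGloballyMinimal] (φ : WeierstrassCurve.Isogeny W W'), Odd φ.degree → IsOrdinaryAt W 2 →
      ∀ x : ℚ, HasUniqueRationalTwoTorsionX W x →
        ∃ x' : ℚ, HasUniqueRationalTwoTorsionX W' x' ∧
          (TwoTorsionRamifiedAtTwo x ↔ TwoTorsionRamifiedAtTwo x') ∧ (TwoTorsionOdd W x ↔ TwoTorsionOdd W' x') := by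
  intro W W' _ _ _ _ φ hdeg hord x hx
  obtain ⟨x', hx', harch⟩ := oddIsoArch W W' φ hdeg hord x hx
  exact ⟨x', hx', hTwoAdic W W' φ hdeg hord x x' hx hx', harch⟩

end OddIso

end Summit.BirchSwinnertonDyer.BirchSwinnertonDyer.Theorems.DepletionAtTwo.ArchTransport

end
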